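import Literature.Analysis.SegalBargmann.HermiteSeminormGrowth
import Literature.Analysis.SegalBargmann.HermiteCoefficientDecay
import Literature.Analysis.SegalBargmann.FockHermiteComplete
import Literature.Analysis.FunctionSpaces.SchwartzComplete
import HarnessLib

/-!
# The Hermite expansion of a Schwartz function converges in `𝒮(ℝⁿ)` — the `N`-representation theorem (Reed–Simon I, Thm V.13)

Topic `Analysis/SegalBargmann`; namespace `Literature.Analysis.SegalBargmann`.  Synthesis of the lane
`HermiteCoefficientDecay` (the Hermite coefficients `c_α(f)` of `f ∈ 𝒮(ℝ^σ)` are rapidly decreasing),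
`HermiteSeminormGrowth` (`p_{k,l}(h_α) ≤ C (|α|+1)^{k+l+n+1}`), the completeness of the Schwartz space
(`Literature.Analysis.FunctionSpaces.completeSpace_schwartzMap`) and the completeness of the Hermite functions in `L²`
(`FockHermiteComplete.hermite_complete`):

* §1 for every RAPIDLY DECREASING family `c` (`Σ_β (|β|+1)^μ ‖c_β‖ < ∞` for all `μ`) the series `Σ_β c_β h_β` is
  summable IN THE SCHWARTZ TOPOLOGY (`summable_smul_hermiteSchwartz_herm`), its sum `g` has Hermite coefficients
  `c_α(g) = c_α` (`hermiteCoeff_of_hasSum`) and Schwartz seminorms `p_{k,l}(g) ≤ C_{k,l} Σ_β (|β|+1)^{k+l+n+1} ‖c_β‖`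
  (`seminorm_le_of_hasSum`);
* §2 a Schwartz function with vanishing Hermite coefficients is zero (`eq_zero_of_forall_hermiteCoeff_eq_zero`);
* §3 hence **every `f ∈ 𝒮(ℝ^σ)` is the sum, in `𝒮(ℝ^σ)`, of its Hermite series**:
  `HasSum (fun β => c_β(f) • h_β) f` (`hasSum_hermiteCoeff_smul_herm`), and `f` is determined by its coefficients.

Together with `HermiteCoefficientDecay` this is the `N`-representation theorem for `𝒮(ℝⁿ)`: `f ↦ (c_α(f))_α` is a
bijection between `𝒮(ℝ^σ)` and the rapidly decreasing families on `ℕ^σ`, continuous in both directions seminorm by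
seminorm.  Everything is proved from Mathlib and the imported tree files; no cited fact is used as a hypothesis.

## References

* M. Reed, B. Simon, *Methods of Modern Mathematical Physics I: Functional Analysis*, Academic Press (1972/1980),
  Theorem V.13 and the Appendix to §V.3 ("the `N`-representation for `𝒮` and `𝒮'`").
* G. B. Folland, *Harmonic Analysis in Phase Space*, Annals of Mathematics Studies 122, Princeton UP (1989), §1.7.
  [cite: Folland1989, §1.7]

## Provenance

Written for the tree under the LEAN-IN-TREE rule (2026-08-18) by the pub-hodgecm formalisation cell (model-construction
sub-cell, seat mc-binder-2).
-/

set_option autoImplicit false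

noncomputable section

open MvPolynomial Complex SchwartzMap MeasureTheory Filter Topology
open scoped BigOperators Real ComplexConjugate

namespace Literature.Analysis.SegalBargmann

variable {σ : Type*} [Fintype σ] [DecidableEq σ]

/-! ## §1  Synthesis: rapidly decreasing families give Schwartz-convergent Hermite series -/

section Synthesis

/-- The seminorm of a finite Hermite combination: if `p_{k,l}(h_α) ≤ C (|α|+1)^μ` for all `α`, then
`p_{k,l}(Σ_{β∈t} c_β h_β) ≤ C Σ_{β∈t} (|β|+1)^μ ‖c_β‖`. [folklore] -/
theorem seminorm_sum_smul_herm_le {k l μ : ℕ} {C : ℝ}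
    (hC : ∀ α : σ →₀ ℕ, SchwartzMap.seminorm ℂ k l (hermiteSchwartz (herm α)) ≤ C * ((α.degree : ℝ) + 1) ^ μ)
    (t : Finset (σ →₀ ℕ)) (c : (σ →₀ ℕ) → ℂ) :
    SchwartzMap.seminorm ℂ k l (∑ β ∈ t, c β • hermiteSchwartz (herm β)) ≤
      C * ∑ β ∈ t, ((β.degree : ℝ) + 1) ^ μ * ‖c β‖ := by
  refine (Finset.le_sum_of_subadditive (SchwartzMap.seminorm ℂ k l) (map_zero _).le (map_add_le_add _) t _).trans ?_
  rw [Finset.mul_sum]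
  refine Finset.sum_le_sum fun β _ => ?_
  rw [map_smul_eq_mul]
  calc ‖c β‖ * SchwartzMap.seminorm ℂ k l (hermiteSchwartz (herm β))
      ≤ ‖c β‖ * (C * ((β.degree : ℝ) + 1) ^ μ) := mul_le_mul_of_nonneg_left (hC β) (norm_nonneg _)
    _ = C * (((β.degree : ℝ) + 1) ^ μ * ‖c β‖) := by ring

/-- **Rapidly decreasing Hermite series are summable in `𝒮(ℝ^σ)`**: if `Σ_β (|β|+1)^μ ‖c_β‖ < ∞` for every `μ`, then
`Σ_β c_β h_β` is summable in the Schwartz topology. [cite: Folland1989, §1.7] -/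
theorem summable_smul_hermiteSchwartz_herm {c : (σ →₀ ℕ) → ℂ}
    (hc : ∀ μ : ℕ, Summable fun β : σ →₀ ℕ => ((β.degree : ℝ) + 1) ^ μ * ‖c β‖) :
    Summable fun β : σ →₀ ℕ => c β • hermiteSchwartz (herm β) := by
  haveI : CompleteSpace 𝓢(EuclideanSpace ℝ σ, ℂ) :=
    Literature.Analysis.FunctionSpaces.completeSpace_schwartzMap
  refine summable_iff_vanishing.mpr fun e he => ?_
  obtain ⟨⟨S, r⟩, hr, hsub⟩ :=
    (schwartz_withSeminorms ℂ (EuclideanSpace ℝ σ) ℂ).hasBasis_zero_ball.mem_iff.mp he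
  dsimp only at hr hsub
  -- for each Schwartz index a tail set beyond which that seminorm of the partial sums is `< r`
  have key : ∀ i : ℕ × ℕ, ∃ s : Finset (σ →₀ ℕ), ∀ t : Finset (σ →₀ ℕ), Disjoint t s →
      SchwartzMap.seminorm ℂ i.1 i.2 (∑ β ∈ t, c β • hermiteSchwartz (herm β)) < r := by
    intro i
    obtain ⟨C, hC0, hC⟩ := exists_seminorm_hermiteSchwartz_herm_le (σ := σ) i.1 i.2
    obtain ⟨s, hs⟩ := summable_iff_vanishing_norm.mp (hc (i.1 + i.2 + Fintype.card σ + 1)) (r / (C + 1))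
      (by positivity)
    refine ⟨s, fun t ht => ?_⟩
    have h1 := seminorm_sum_smul_herm_le hC t c
    have h2 := hs t ht
    rw [Real.norm_of_nonneg (Finset.sum_nonneg fun β _ => by positivity)] at h2
    calc SchwartzMap.seminorm ℂ i.1 i.2 (∑ β ∈ t, c β • hermiteSchwartz (herm β))
        ≤ C * ∑ β ∈ t, ((β.degree : ℝ) + 1) ^ (i.1 + i.2 + Fintype.card σ + 1) * ‖c β‖ := h1
      _ ≤ C * (r / (C + 1)) := mul_le_mul_of_nonneg_left h2.le hC0
      _ < r := by
          rw [mul_div_assoc', div_lt_iff₀ (by positivity)]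
          nlinarith
  choose s hs using key
  refine ⟨S.sup s, fun t ht => hsub ?_⟩
  rw [Seminorm.mem_ball, sub_zero]
  exact Seminorm.finset_sup_apply_lt hr fun i hi => hs i t (ht.mono_right (Finset.le_sup hi))

/-- **The coefficients of a Schwartz-convergent Hermite series**: if `Σ_β c_β h_β = g` in `𝒮(ℝ^σ)` then
`c_α(g) = c_α` (continuity of the coefficient functional and orthonormality). [cite: Folland1989, §1.7] -/
theorem hermiteCoeff_of_hasSum {c : (σ →₀ ℕ) → ℂ} {g : 𝓢(EuclideanSpace ℝ σ, ℂ)}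
    (h : HasSum (fun β : σ →₀ ℕ => c β • hermiteSchwartz (herm β)) g) (α : σ →₀ ℕ) :
    hermiteCoeff α g = c α := by
  have h1 := (hermiteCoeffCLM α).hasSum h
  simp only [hermiteCoeffCLM_apply, hermiteCoeff_smul, hermiteCoeff_herm] at h1
  have h2 : HasSum (fun β : σ →₀ ℕ => c β * if α = β then (1 : ℂ) else 0) (c α) := by
    have h3 := hasSum_ite_eq α (c α)
    refine h3.congr_fun fun β => ?_
    by_cases hβ : β = α
    · subst hβ
      simp
    · simp [hβ, Ne.symm hβ]
  exact h1.unique h2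

/-- **Seminorm bound for the sum**: if `p_{k,l}(h_α) ≤ C (|α|+1)^μ` for all `α` (`C ≥ 0`), `Σ_β c_β h_β = g` in
`𝒮(ℝ^σ)` and `Σ_β (|β|+1)^μ ‖c_β‖ < ∞`, then `p_{k,l}(g) ≤ C Σ_β (|β|+1)^μ ‖c_β‖`. [cite: Folland1989, §1.7] -/
theorem seminorm_le_of_hasSum {k l μ : ℕ} {C : ℝ} (hC0 : 0 ≤ C)
    (hC : ∀ α : σ →₀ ℕ, SchwartzMap.seminorm ℂ k l (hermiteSchwartz (herm α)) ≤ C * ((α.degree : ℝ) + 1) ^ μ)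
    {c : (σ →₀ ℕ) → ℂ} {g : 𝓢(EuclideanSpace ℝ σ, ℂ)}
    (h : HasSum (fun β : σ →₀ ℕ => c β • hermiteSchwartz (herm β)) g)
    (hw : Summable fun β : σ →₀ ℕ => ((β.degree : ℝ) + 1) ^ μ * ‖c β‖) :
    SchwartzMap.seminorm ℂ k l g ≤ C * ∑' β : σ →₀ ℕ, ((β.degree : ℝ) + 1) ^ μ * ‖c β‖ := by
  have hcont : Continuous fun u : 𝓢(EuclideanSpace ℝ σ, ℂ) => SchwartzMap.seminorm ℂ k l u :=
    (schwartz_withSeminorms ℂ (EuclideanSpace ℝ σ) ℂ).continuous_seminorm (k, l)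
  have ht : Tendsto (fun t : Finset (σ →₀ ℕ) =>
      SchwartzMap.seminorm ℂ k l (∑ β ∈ t, c β • hermiteSchwartz (herm β))) atTop
      (𝓝 (SchwartzMap.seminorm ℂ k l g)) :=
    (hcont.tendsto g).comp h
  refine le_of_tendsto' ht fun t => (seminorm_sum_smul_herm_le hC t c).trans ?_
  exact mul_le_mul_of_nonneg_left (hw.sum_le_tsum t fun β _ => by positivity) hC0

/-- **Synthesis with seminorm control**: for a rapidly decreasing family `c` the Schwartz function `g = Σ_β c_β h_β`
satisfies, for every `k, l`, `p_{k,l}(g) ≤ C_{k,l} Σ_β (|β|+1)^{k+l+n+1} ‖c_β‖` with the constant of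
`exists_seminorm_hermiteSchwartz_herm_le` (independent of `c`). [cite: Folland1989, §1.7] -/
theorem exists_seminorm_tsum_le (k l : ℕ) :
    ∃ C : ℝ, 0 ≤ C ∧ ∀ (c : (σ →₀ ℕ) → ℂ),
      (∀ μ : ℕ, Summable fun β : σ →₀ ℕ => ((β.degree : ℝ) + 1) ^ μ * ‖c β‖) →
        SchwartzMap.seminorm ℂ k l (∑' β : σ →₀ ℕ, c β • hermiteSchwartz (herm β)) ≤
          C * ∑' β : σ →₀ ℕ, ((β.degree : ℝ) + 1) ^ (k + l + Fintype.card σ + 1) * ‖c β‖ := by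
  obtain ⟨C, hC0, hC⟩ := exists_seminorm_hermiteSchwartz_herm_le (σ := σ) k l
  exact ⟨C, hC0, fun c hc =>
    seminorm_le_of_hasSum hC0 hC (summable_smul_hermiteSchwartz_herm hc).hasSum (hc _)⟩

end Synthesis

/-! ## §2  Uniqueness: a Schwartz function is determined by its Hermite coefficients -/

section Uniqueness

/-- **A Schwartz function all of whose Hermite coefficients vanish is zero** (completeness of the Hermite functions
in `L²(ℝ^σ)`, `FockHermiteComplete.hermite_complete`, and continuity). [cite: Folland1989, §1.7] -/
theorem eq_zero_of_forall_hermiteCoeff_eq_zero (f : 𝓢(EuclideanSpace ℝ σ, ℂ))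
    (h : ∀ α : σ →₀ ℕ, hermiteCoeff α f = 0) : f = 0 := by
  -- transport `f` to `σ → ℝ`
  set g : (σ → ℝ) → ℂ := fun y => f (WithLp.toLp 2 y) with hg
  have hgf : ∀ x : EuclideanSpace ℝ σ, g (WithLp.ofLp x) = f x := fun x => by
    simp only [hg, WithLp.toLp_ofLp]
  have hg2 : MemLp g 2 (volume : Measure (σ → ℝ)) :=
    (f.memLp 2 (μ := (volume : Measure (EuclideanSpace ℝ σ)))).comp_measurePreserving
      (PiLp.volume_preserving_toLp σ)
  have horth : ∀ α : σ →₀ ℕ, ∫ y : σ → ℝ, g y * conj (hermiteFun (herm α) y) = 0 := fun α => by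
    have h1 : ∫ x : EuclideanSpace ℝ σ, g (⇑x) * conj (hermiteFun (herm α) (⇑x)) =
        ∫ y : σ → ℝ, g y * conj (hermiteFun (herm α) y) :=
      integral_euclidean_eq_integral_pi (fun y => g y * conj (hermiteFun (herm α) y))
    rw [← h1]
    have h2 : ∀ x : EuclideanSpace ℝ σ, g (⇑x) * conj (hermiteFun (herm α) (⇑x)) =
        hermiteSchwartz (herm α) x * f x := fun x => by
      rw [hgf, ← hermiteSchwartz_apply, conj_hermiteSchwartz_herm, mul_comm]
    simp_rw [h2]
    rw [← hermiteCoeff_apply]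
    exact h α
  have hae : g =ᵐ[volume] 0 := hermite_complete hg2 horth
  -- back to `EuclideanSpace ℝ σ`
  have hae' : (⇑f : EuclideanSpace ℝ σ → ℂ) =ᵐ[volume] 0 := by
    have h3 := (PiLp.volume_preserving_ofLp σ).quasiMeasurePreserving.ae_eq_comp hae
    refine h3.mono fun x hx => ?_
    simpa only [Function.comp_apply, hgf, Pi.zero_apply] using hx
  have hzero : (⇑f : EuclideanSpace ℝ σ → ℂ) = 0 :=
    Measure.eq_of_ae_eq hae' f.continuous continuous_const
  ext x
  exact congrFun hzero x

/-- Two Schwartz functions with the same Hermite coefficients are equal. [cite: Folland1989, §1.7] -/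
theorem ext_hermiteCoeff {f g : 𝓢(EuclideanSpace ℝ σ, ℂ)} (h : ∀ α : σ →₀ ℕ, hermiteCoeff α f = hermiteCoeff α g) :
    f = g := by
  rw [← sub_eq_zero]
  refine eq_zero_of_forall_hermiteCoeff_eq_zero _ fun α => ?_
  rw [← hermiteCoeffCLM_apply, map_sub, hermiteCoeffCLM_apply, hermiteCoeffCLM_apply, h α, sub_self]

end Uniqueness

/-! ## §3  The Hermite expansion of a Schwartz function -/

section Expansion

/-- **The `N`-representation theorem, expansion half**: every Schwartz function on `ℝ^σ` is the sum IN `𝒮(ℝ^σ)` of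
its Hermite series, `f = Σ_β c_β(f) h_β`. [cite: Folland1989, §1.7] -/
theorem hasSum_hermiteCoeff_smul_herm (f : 𝓢(EuclideanSpace ℝ σ, ℂ)) :
    HasSum (fun β : σ →₀ ℕ => hermiteCoeff β f • hermiteSchwartz (herm β)) f := by
  have hsum := summable_smul_hermiteSchwartz_herm (summable_degree_pow_mul_norm_hermiteCoeff · f)
  have heq : ∑' β : σ →₀ ℕ, hermiteCoeff β f • hermiteSchwartz (herm β) = f :=
    ext_hermiteCoeff fun α => hermiteCoeff_of_hasSum hsum.hasSum α
  have h := hsum.hasSum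
  rwa [heq] at h

/-- The Hermite series of a Schwartz function is summable in `𝒮(ℝ^σ)`. [cite: Folland1989, §1.7] -/
theorem summable_hermiteCoeff_smul_herm (f : 𝓢(EuclideanSpace ℝ σ, ℂ)) :
    Summable fun β : σ →₀ ℕ => hermiteCoeff β f • hermiteSchwartz (herm β) :=
  (hasSum_hermiteCoeff_smul_herm f).summable

/-- `f = Σ' c_β(f) h_β` in `𝒮(ℝ^σ)`. [cite: Folland1989, §1.7] -/
theorem tsum_hermiteCoeff_smul_herm (f : 𝓢(EuclideanSpace ℝ σ, ℂ)) :
    ∑' β : σ →₀ ℕ, hermiteCoeff β f • hermiteSchwartz (herm β) = f :=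
  (hasSum_hermiteCoeff_smul_herm f).tsum_eq

/-- **Pointwise Hermite expansion**: `f(x) = Σ_β c_β(f) h_β(x)` for every `x` (evaluation is continuous on `𝒮`).
[cite: Folland1989, §1.7] -/
theorem hasSum_hermiteCoeff_mul_herm_apply (f : 𝓢(EuclideanSpace ℝ σ, ℂ)) (x : EuclideanSpace ℝ σ) :
    HasSum (fun β : σ →₀ ℕ => hermiteCoeff β f * hermiteSchwartz (herm β) x) (f x) := by
  have h := (hasSum_hermiteCoeff_smul_herm f).map
    (SchwartzMap.toBoundedContinuousFunctionCLM ℂ (EuclideanSpace ℝ σ) ℂ)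
    (SchwartzMap.toBoundedContinuousFunctionCLM ℂ (EuclideanSpace ℝ σ) ℂ).continuous
  have h2 := h.map (BoundedContinuousFunction.evalCLM ℂ x) (BoundedContinuousFunction.evalCLM ℂ x).continuous
  refine h2.congr_fun fun β => ?_
  simp [Function.comp_apply, smul_eq_mul]

end Expansion

end Literature.Analysis.SegalBargmann

end
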